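import Mathlib
import HarnessLib
import Literature.Probability.Percolation.MinOpenCut
import Literature.Probability.Percolation.MinOpenCutMenger
import Literature.Probability.Percolation.SharpnessDCTProofs
import Literature.Probability.Percolation.LatticeSymmetry
import Literature.Probability.Percolation.SitePaths

/-!
# `stub_patchCutset` of line `Sketch` (crux `BudgetTightness`, stmt-CriticalPhenomena-5248):
# the patch-cutset inequality `E_p[S(L, 2lm)] ≤ ⌈(L+1)/(2m+1)⌉² · E_p[MinCut(m, lm)]`

`MinCut(m, lm) = minOpenCutIn B(lm) B(m) ∂ⁱⁿB(lm)` is the annulus min-cut budget (`MinOpenCut.lean`) and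
`S(L, h) = minOpenCutIn Q bottom top` the bottom-to-top min-cut of the piece `Q = [0, L]² × [0, h]`.
Proof (elementary, one scale, every `p`). NET: with `h = 2lm`, `A = (L + 2m + 1)/(2m+1)`, the boxes
`c_{ab} + B(m)`, `c_{ab} = ((2m+1)a + m, (2m+1)b + m, lm)`, `a, b < A`, cover the mid layer `{x₂ = lm}`
(`exists_centre`, `exists_net_centre`). ROUTING (lattice configurations, paths as relations `PathIn`):
an open bottom-to-top path last leaves `{x₂ < lm}` through a mid-layer vertex `b ∈ c + B(m)`
(`exists_mid`), and from `b` it either stays in `c + B(lm)` up to the top face ⊆ `c + ∂ⁱⁿB(lm)` or first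
exits `c + B(lm)` through `c + ∂ⁱⁿB(lm)` (`cross_annulus`); so it crosses one of the `≤ A²` translated
annuli (`route`). UNION OF CUTSETS: glue optimal cutsets of the translated annuli
(`minOpenCutIn_le_sum_of_subRouting`, lattice-restricted variant of `minOpenCutIn_le_sum_of_routing`).
TRANSLATION INVARIANCE (`minOpenCutIn_image_relabel`, `bondPercolation_map_shift`): each translated
annulus has expected budget `E_p[MinCut(m, lm)]`. INTEGRATION: finite-region budgets are integrable
(`integral_piece_le_card_mul`).
-/

noncomputable section

namespace Summit.CriticalPhenomena.PercolationContinuityZ3.Theorems.BudgetTightness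

open MeasureTheory ProbabilityTheory
open Literature.Probability.Percolation Literature.Probability.LatticeModels

namespace StubPatchCutset

/-! ### General facts about the min-cut budget -/
section General

variable {V W : Type*}

/-- **Budgets add along a routing of sub-configurations** (variant of `minOpenCutIn_le_sum_of_routing`
whose routing hypothesis is only asked of the `ω' ⊆ ω`, the only configurations it is applied to):
`MinCut_S(A, B)(ω) ≤ ∑_{i ∈ s} MinCut_{Si i}(Ai i, Bi i)(ω)`. -/
theorem minOpenCutIn_le_sum_of_subRouting {ι : Type*} (s : Finset ι) {S A B : Set V}
    {Si Ai Bi : ι → Set V} {ω : BondConfig V}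
    (hroute : ∀ ω' ⊆ ω, ∀ x ∈ A, ∀ y ∈ B, ω' ∈ openConnIn S x y →
      ∃ i ∈ s, ∃ x' ∈ Ai i, ∃ y' ∈ Bi i, ω' ∈ openConnIn (Si i) x' y') :
    minOpenCutIn S A B ω ≤ ∑ i ∈ s, minOpenCutIn (Si i) (Ai i) (Bi i) ω := by
  classical
  by_cases htop : ∃ i ∈ s, minOpenCutIn (Si i) (Ai i) (Bi i) ω = ⊤
  · exact (ENat.sum_eq_top.2 htop).symm ▸ le_top
  push Not at htop
  have key : ∀ i, ∃ T : Finset (Sym2 V), i ∈ s → IsOpenCutsetIn (Si i) (Ai i) (Bi i) ω ↑T ∧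
      (T.card : ℕ∞) = minOpenCutIn (Si i) (Ai i) (Bi i) ω := fun i => by
    by_cases hi : i ∈ s
    · obtain ⟨T, hT, hc⟩ := exists_eq_minOpenCutIn (htop i hi)
      exact ⟨T, fun _ => ⟨hT, hc⟩⟩
    · exact ⟨∅, fun h => absurd h hi⟩
  choose T hT using key
  have hU : IsOpenCutsetIn S A B ω ↑(s.biUnion T) := by
    intro x hx y hy hω
    obtain ⟨i, hi, x', hx', y', hy', h'⟩ := hroute _ Set.sdiff_subset x hx y hy hω
    exact ((hT i hi).1.mono (Finset.coe_subset.2 (Finset.subset_biUnion_of_mem T hi)))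
      x' hx' y' hy' h'
  calc minOpenCutIn S A B ω ≤ ((s.biUnion T).card : ℕ∞) := minOpenCutIn_le_card hU
    _ ≤ ((∑ i ∈ s, (T i).card : ℕ) : ℕ∞) := by exact_mod_cast Finset.card_biUnion_le
    _ = ∑ i ∈ s, minOpenCutIn (Si i) (Ai i) (Bi i) ω := by
        rw [Nat.cast_sum]
        exact Finset.sum_congr rfl fun i hi => (hT i hi).2

/-- **Transport of the budget along a bijection, `≤`**: `ω ↦ φ '' ω` carries open cutsets of
`(S, A, B)` to open cutsets of `(φ S, φ A, φ B)` of the same size. -/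
theorem minOpenCutIn_image_relabel_le (φ : V ≃ W) (S A B : Set V) (ω : BondConfig V) :
    minOpenCutIn (φ '' S) (φ '' A) (φ '' B) (BondConfig.relabel (sym2Equiv φ) ω) ≤
      minOpenCutIn S A B ω := by
  classical
  refine le_iInf₂ fun T hT => ?_
  have hT' : IsOpenCutsetIn (φ '' S) (φ '' A) (φ '' B) (BondConfig.relabel (sym2Equiv φ) ω)
      ↑(T.image (sym2Equiv φ)) := by
    rintro _ ⟨x, hx, rfl⟩ _ ⟨y, hy, rfl⟩ hconn
    have h := relabel_mem_openConnIn φ.symm hconn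
    have key : BondConfig.relabel (sym2Equiv φ.symm)
        (BondConfig.relabel (sym2Equiv φ) ω \ ↑(T.image (sym2Equiv φ))) = ω \ ↑T := by
      rw [BondConfig.relabel_apply, BondConfig.relabel_apply, Finset.coe_image,
        ← Set.image_sdiff (sym2Equiv φ).injective, ← sym2Equiv_symm, Equiv.symm_image_image]
    rw [key, Equiv.symm_image_image, Equiv.symm_apply_apply, Equiv.symm_apply_apply] at h
    exact hT x hx y hy h
  calc minOpenCutIn (φ '' S) (φ '' A) (φ '' B) (BondConfig.relabel (sym2Equiv φ) ω)
      ≤ ((T.image (sym2Equiv φ)).card : ℕ∞) := minOpenCutIn_le_card hT'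
    _ = T.card := by rw [Finset.card_image_of_injective _ (sym2Equiv φ).injective]

/-- **Transport of the budget along a bijection**: `MinCut_{φ S}(φ A, φ B)(φ '' ω) = MinCut_S(A, B)(ω)`. -/
theorem minOpenCutIn_image_relabel (φ : V ≃ W) (S A B : Set V) (ω : BondConfig V) :
    minOpenCutIn (φ '' S) (φ '' A) (φ '' B) (BondConfig.relabel (sym2Equiv φ) ω) =
      minOpenCutIn S A B ω := by
  refine le_antisymm (minOpenCutIn_image_relabel_le φ S A B ω) ?_
  have h := minOpenCutIn_image_relabel_le φ.symm (φ '' S) (φ '' A) (φ '' B)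
    (BondConfig.relabel (sym2Equiv φ) ω)
  rwa [Equiv.symm_image_image, Equiv.symm_image_image, Equiv.symm_image_image,
    relabel_symm_relabel] at h

/-- **Uniform bound on a finite region**: `MinCut_S(A, B)(ω).toNat ≤ #pairs(S)` (either the budget is
`⊤`, with `toNat = 0`, or `A ∩ B ∩ S = ∅` and closing all pairs inside `S` is a cutset). -/
theorem toNat_minOpenCutIn_le {S : Set V} (hS : S.Finite) (A B : Set V) (ω : BondConfig V) :
    (minOpenCutIn S A B ω).toNat ≤ hS.toFinset.sym2.card := by
  classical
  by_cases htop : minOpenCutIn S A B ω = ⊤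
  · simp [htop]
  have hAB : ¬ ∃ a ∈ S, a ∈ A ∧ a ∈ B := fun h =>
    htop ((minOpenCutIn_eq_top_iff_of_finite hS A B ω).2 h)
  refine ENat.toNat_le_of_le_coe (minOpenCutIn_le_card fun x hx y hy hω => ?_)
  obtain ⟨hxS, hyS, ⟨p⟩⟩ := hω
  cases p with
  | nil => exact hAB ⟨x, hxS, hx, hy⟩
  | cons hadj _ =>
    rw [SimpleGraph.induce_adj, openGraph_adj] at hadj
    refine hadj.1.2 ?_
    rw [Finset.mem_coe, Finset.mk_mem_sym2_iff, Set.Finite.mem_toFinset, Set.Finite.mem_toFinset]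
    exact ⟨hxS, Subtype.prop _⟩

/-- **Measurability of the budget on a finite region** (`measurableSet_setOf_minOpenCutIn_le`). -/
theorem measurable_minOpenCutIn {S : Set V} (hS : S.Finite) (A B : Set V) :
    Measurable (minOpenCutIn S A B) := by
  have hle : ∀ z : ℕ∞, MeasurableSet {ω | minOpenCutIn S A B ω ≤ z} := by
    intro z
    induction z using ENat.recTopCoe with
    | top => simp
    | coe k => exact measurableSet_setOf_minOpenCutIn_le hS A B k
  refine measurable_to_countable' fun z => ?_
  have : minOpenCutIn S A B ⁻¹' {z} =
      {ω | minOpenCutIn S A B ω ≤ z} \ ⋃ w ∈ {w | w < z}, {ω | minOpenCutIn S A B ω ≤ w} := by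
    ext ω
    simp only [Set.mem_preimage, Set.mem_singleton_iff, Set.mem_sdiff, Set.mem_setOf_eq,
      Set.mem_iUnion, exists_prop, not_exists, not_and]
    exact ⟨fun h => ⟨h.le, fun w hw hle' => absurd (hle'.trans_lt hw) (h ▸ lt_irrefl _)⟩,
      fun h => le_antisymm h.1 (not_lt.1 fun hlt => h.2 _ hlt le_rfl)⟩
  rw [this]
  exact (hle z).diff (MeasurableSet.biUnion (Set.to_countable _) fun w _ => hle w)

/-- **Integrability of the real-valued budget on a finite region** under a finite measure. -/
theorem integrable_toNat_minOpenCutIn {S : Set V} (hS : S.Finite) (A B : Set V)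
    (μ : Measure (BondConfig V)) [IsFiniteMeasure μ] :
    Integrable (fun ω => ((minOpenCutIn S A B ω).toNat : ℝ)) μ := by
  have hm : Measurable fun ω => ((minOpenCutIn S A B ω).toNat : ℝ) :=
    (measurable_of_countable fun j : ℕ => (j : ℝ)).comp
      ((measurable_of_countable ENat.toNat).comp (measurable_minOpenCutIn hS A B))
  refine Integrable.of_bound hm.aestronglyMeasurable (hS.toFinset.sym2.card : ℝ)
    (Filter.Eventually.of_forall fun ω => ?_)
  rw [Real.norm_eq_abs, abs_of_nonneg (Nat.cast_nonneg _)]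
  exact_mod_cast toNat_minOpenCutIn_le hS A B ω

end General

/-! ### Translated annuli: translation invariance and finiteness of the budget -/

/-- Membership in a translate: `v ∈ S + c ↔ v - c ∈ S`. -/
theorem mem_image_add_iff {c v : Site 3} {S : Set (Site 3)} : v ∈ (· + c) '' S ↔ v - c ∈ S :=
  ⟨fun ⟨x, hx, hxv⟩ => by simpa [← hxv] using hx, fun h => ⟨v - c, h, sub_add_cancel v c⟩⟩

/-- The budget of a translated triple at the translated configuration is the budget. -/
theorem minOpenCutIn_shift (c : Site 3) (S A B : Set (Site 3)) (ω : BondConfig (Site 3)) :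
    minOpenCutIn ((· + c) '' S) ((· + c) '' A) ((· + c) '' B)
        (BondConfig.relabel (sym2Equiv (Site.shift c)) ω) = minOpenCutIn S A B ω :=
  minOpenCutIn_image_relabel (Site.shift c) S A B ω

/-- **Translation invariance** `E_p[MinCut_{S + c}(A + c, B + c)] = E_p[MinCut_S(A, B)]`. -/
theorem integral_toNat_minOpenCutIn_shift (p : unitInterval) (c : Site 3) (S A B : Set (Site 3)) :
    ∫ ω, ((minOpenCutIn ((· + c) '' S) ((· + c) '' A) ((· + c) '' B) ω).toNat : ℝ)
        ∂(bondPercolation (zdGraph 3) p) =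
      ∫ ω, ((minOpenCutIn S A B ω).toNat : ℝ) ∂(bondPercolation (zdGraph 3) p) := by
  calc ∫ ω, ((minOpenCutIn ((· + c) '' S) ((· + c) '' A) ((· + c) '' B) ω).toNat : ℝ)
        ∂(bondPercolation (zdGraph 3) p)
      = ∫ ω, ((minOpenCutIn ((· + c) '' S) ((· + c) '' A) ((· + c) '' B) ω).toNat : ℝ)
        ∂((bondPercolation (zdGraph 3) p).map
          (BondConfig.relabel (sym2Equiv (Site.shift c)))) := by rw [bondPercolation_map_shift]
    _ = ∫ ω, ((minOpenCutIn S A B ω).toNat : ℝ) ∂(bondPercolation (zdGraph 3) p) := by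
        rw [integral_map_equiv]; simp_rw [minOpenCutIn_shift]

/-- The translated annulus budgets are finite: for `1 ≤ m`, `2 ≤ l` the inner box `B(m)` misses the
inner vertex boundary of `B(lm)` (a lattice neighbour of a site of `B(m)` lies in `B(m+1) ⊆ B(lm)`). -/
theorem shiftedBudget_ne_top {m l : ℕ} (hm : 1 ≤ m) (hl : 2 ≤ l) (c : Site 3)
    (ω : BondConfig (Site 3)) :
    minOpenCutIn ((· + c) '' (↑(box 3 (l * m)) : Set (Site 3))) ((· + c) '' ↑(box 3 m))
      ((· + c) '' ↑(innerBoundary (zdGraph 3) (box 3 (l * m)))) ω ≠ ⊤ := by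
  rw [Ne, minOpenCutIn_eq_top_iff_of_finite ((Finset.finite_toSet _).image _)]
  rintro ⟨a, -, haA, haB⟩
  obtain ⟨-, y, hy, hadj⟩ :=
    mem_innerBoundary_iff.1 (Finset.mem_coe.1 (mem_image_add_iff.1 haB))
  exact hy (box_mono 3 (by nlinarith)
    (DCT16.mem_box_succ_of_adj (Finset.mem_coe.1 (mem_image_add_iff.1 haA)) hadj))

/-- **Integration of a patch-cutset routing.** If, on lattice configurations, every open bottom-to-top
crossing of the piece `[0, L]² × [0, 2lm]` crosses a translated annulus `c + (B(m) → ∂ⁱⁿB(lm))` inside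
`c + B(lm)` with `c ∈ s`, then `E_p[S(L, 2lm)] ≤ #s · E_p[MinCut(m, lm)]` (a.s. `S ≤ Σ_{c ∈ s}` translated
budgets by `minOpenCutIn_le_sum_of_subRouting`; each has expectation `E_p[MinCut(m, lm)]`). -/
theorem integral_piece_le_card_mul (p : unitInterval) {m l L : ℕ} (hm : 1 ≤ m) (hl : 2 ≤ l)
    (s : Finset (Site 3))
    (hroute : ∀ ω ⊆ (zdGraph 3).edgeSet, ∀ x ∈ Set.Icc (![0, 0, 0] : Site 3) ![(L : ℤ), (L : ℤ), 0],
      ∀ y ∈ Set.Icc (![0, 0, ((2 * l * m : ℕ) : ℤ)] : Site 3) ![(L : ℤ), (L : ℤ), ((2 * l * m : ℕ) : ℤ)],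
      ω ∈ openConnIn (Set.Icc (![0, 0, 0] : Site 3) ![(L : ℤ), (L : ℤ), ((2 * l * m : ℕ) : ℤ)]) x y →
        ∃ c ∈ s, ∃ x' ∈ (· + c) '' (↑(box 3 m) : Set (Site 3)),
          ∃ y' ∈ (· + c) '' (↑(innerBoundary (zdGraph 3) (box 3 (l * m))) : Set (Site 3)),
            ω ∈ openConnIn ((· + c) '' (↑(box 3 (l * m)) : Set (Site 3))) x' y') :
    ∫ ω, ((minOpenCutIn
        (Set.Icc (![0, 0, 0] : Site 3) ![(L : ℤ), (L : ℤ), ((2 * l * m : ℕ) : ℤ)])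
        (Set.Icc (![0, 0, 0] : Site 3) ![(L : ℤ), (L : ℤ), 0])
        (Set.Icc (![0, 0, ((2 * l * m : ℕ) : ℤ)] : Site 3) ![(L : ℤ), (L : ℤ), ((2 * l * m : ℕ) : ℤ)])
        ω).toNat : ℝ) ∂(bondPercolation (zdGraph 3) p) ≤
      (s.card : ℝ) * ∫ ω, ((minOpenCutIn (↑(box 3 (l * m)) : Set (Site 3)) (↑(box 3 m) : Set (Site 3))
        (↑(innerBoundary (zdGraph 3) (box 3 (l * m))) : Set (Site 3)) ω).toNat : ℝ)
        ∂(bondPercolation (zdGraph 3) p) := by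
  set Q : Set (Site 3) := Set.Icc (![0, 0, 0] : Site 3) ![(L : ℤ), (L : ℤ), ((2 * l * m : ℕ) : ℤ)]
  set bot : Set (Site 3) := Set.Icc (![0, 0, 0] : Site 3) ![(L : ℤ), (L : ℤ), 0]
  set top : Set (Site 3) :=
    Set.Icc (![0, 0, ((2 * l * m : ℕ) : ℤ)] : Site 3) ![(L : ℤ), (L : ℤ), ((2 * l * m : ℕ) : ℤ)]
  set TB : Site 3 → BondConfig (Site 3) → ℕ∞ := fun c ω =>
    minOpenCutIn ((· + c) '' (↑(box 3 (l * m)) : Set (Site 3))) ((· + c) '' ↑(box 3 m))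
      ((· + c) '' ↑(innerBoundary (zdGraph 3) (box 3 (l * m)))) ω
  -- the patch-cutset inequality, a.s. on `ω ⊆ E(ℤ³)` (routing + union of optimal cutsets)
  have hpt : ∀ᵐ ω ∂(bondPercolation (zdGraph 3) p),
      ((minOpenCutIn Q bot top ω).toNat : ℝ) ≤ ∑ c ∈ s, ((TB c ω).toNat : ℝ) := by
    filter_upwards [(setBernoulli_ae_subset :
      ∀ᵐ ω ∂(bondPercolation (zdGraph 3) p), ω ⊆ (zdGraph 3).edgeSet)] with ω hω
    have h1 : minOpenCutIn Q bot top ω ≤ ∑ c ∈ s, TB c ω :=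
      minOpenCutIn_le_sum_of_subRouting s
        fun ω' hω' x hx y hy hxy => hroute ω' (hω'.trans hω) x hx y hy hxy
    have h2 : ∑ c ∈ s, TB c ω = ((∑ c ∈ s, (TB c ω).toNat : ℕ) : ℕ∞) := by
      rw [Nat.cast_sum]
      exact Finset.sum_congr rfl fun c _ => (ENat.coe_toNat (shiftedBudget_ne_top hm hl c ω)).symm
    exact_mod_cast ENat.toNat_le_of_le_coe (h1.trans_eq h2)
  have hint : ∀ c, Integrable (fun ω => ((TB c ω).toNat : ℝ)) (bondPercolation (zdGraph 3) p) :=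
    fun c => integrable_toNat_minOpenCutIn ((Finset.finite_toSet _).image _) _ _ _
  calc ∫ ω, ((minOpenCutIn Q bot top ω).toNat : ℝ) ∂(bondPercolation (zdGraph 3) p)
      ≤ ∫ ω, ∑ c ∈ s, ((TB c ω).toNat : ℝ) ∂(bondPercolation (zdGraph 3) p) :=
          integral_mono_ae (integrable_toNat_minOpenCutIn (Set.finite_Icc _ _) _ _ _)
            (integrable_finsetSum _ fun c _ => hint c) hpt
    _ = ∑ c ∈ s, ∫ ω, ((minOpenCutIn (↑(box 3 (l * m)) : Set (Site 3)) ↑(box 3 m)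
          ↑(innerBoundary (zdGraph 3) (box 3 (l * m))) ω).toNat : ℝ) ∂(bondPercolation (zdGraph 3) p) := by
          rw [integral_finsetSum _ fun c _ => hint c]
          exact Finset.sum_congr rfl fun c _ => integral_toNat_minOpenCutIn_shift p _ _ _ _
    _ = _ := by rw [Finset.sum_const, nsmul_eq_mul]

/-! ### The net of centres and the routing -/

/-- Membership in a coordinate box `Set.Icc ![a₀,a₁,a₂] ![b₀,b₁,b₂]` of `ℤ³`, one coordinate at a time. -/
theorem mem_Icc_vec3 {a₀ a₁ a₂ b₀ b₁ b₂ : ℤ} {x : Site 3} :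
    x ∈ Set.Icc (![a₀, a₁, a₂] : Site 3) ![b₀, b₁, b₂] ↔
      (a₀ ≤ x 0 ∧ x 0 ≤ b₀) ∧ (a₁ ≤ x 1 ∧ x 1 ≤ b₁) ∧ (a₂ ≤ x 2 ∧ x 2 ≤ b₂) := by
  simp only [Set.mem_Icc, Pi.le_def, Fin.forall_fin_succ, IsEmpty.forall_iff, and_true,
    Matrix.cons_val_zero, Matrix.cons_val_succ, Fin.succ_zero_eq_one, Fin.succ_one_eq_two]
  tauto

/-- **One coordinate of the net**: every `t ∈ [0, L]` is within `m` of some `(2m+1) a + m` with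
`a < A = (L + 2m + 1)/(2m+1)`. -/
theorem exists_centre (m L : ℕ) {t : ℤ} (ht0 : 0 ≤ t) (htL : t ≤ L) :
    ∃ a : ℕ, a < (L + 2 * m + 1) / (2 * m + 1) ∧
      -(m : ℤ) ≤ t - (((2 * m + 1) * a + m : ℕ) : ℤ) ∧ t - (((2 * m + 1) * a + m : ℕ) : ℤ) ≤ m := by
  have hN : 0 < 2 * m + 1 := by omega
  have h5 : (t.toNat : ℤ) = t := Int.toNat_of_nonneg ht0
  refine ⟨t.toNat / (2 * m + 1), ?_, ?_⟩
  · have h1 : t.toNat ≤ L := by omega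
    have h2 : (L + 2 * m + 1) / (2 * m + 1) = L / (2 * m + 1) + 1 := by
      rw [show L + 2 * m + 1 = L + (2 * m + 1) by ring, Nat.add_div_right L hN]
    exact h2 ▸ Nat.lt_succ_of_le (Nat.div_le_div_right h1)
  · obtain ⟨P, hP⟩ : ∃ P, (2 * m + 1) * (t.toNat / (2 * m + 1)) = P := ⟨_, rfl⟩
    have h3 : P + t.toNat % (2 * m + 1) = t.toNat := by rw [← hP]; exact Nat.div_add_mod _ _
    have h4 := Nat.mod_lt t.toNat hN
    rw [hP]
    constructor <;> omega

/-- **The net covers the mid layer**: a vertex `b` of the piece with `b₂ = lm` lies in `c + B(m)` for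
some centre `c = ((2m+1)a + m, (2m+1)b + m, lm)`, `(a, b) ∈ range A ×ˢ range A`. -/
theorem exists_net_centre (m l L : ℕ) {b : Site 3} (h0 : 0 ≤ b 0 ∧ b 0 ≤ L)
    (h1 : 0 ≤ b 1 ∧ b 1 ≤ L) (h2 : b 2 = ((l * m : ℕ) : ℤ)) :
    ∃ c ∈ (Finset.range ((L + 2 * m + 1) / (2 * m + 1)) ×ˢ
        Finset.range ((L + 2 * m + 1) / (2 * m + 1))).image fun ab : ℕ × ℕ =>
          (![(((2 * m + 1) * ab.1 + m : ℕ) : ℤ), (((2 * m + 1) * ab.2 + m : ℕ) : ℤ),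
            ((l * m : ℕ) : ℤ)] : Site 3),
      b - c ∈ box 3 m ∧ c 2 = ((l * m : ℕ) : ℤ) := by
  obtain ⟨ia, hia, hia1, hia2⟩ := exists_centre m L h0.1 h0.2
  obtain ⟨ib, hib, hib1, hib2⟩ := exists_centre m L h1.1 h1.2
  have hab : (ia, ib) ∈ Finset.range ((L + 2 * m + 1) / (2 * m + 1)) ×ˢ
      Finset.range ((L + 2 * m + 1) / (2 * m + 1)) :=
    Finset.mem_product.2 ⟨Finset.mem_range.2 hia, Finset.mem_range.2 hib⟩
  refine ⟨_, Finset.mem_image_of_mem _ hab, ?_, rfl⟩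
  simp only [mem_box, Fin.forall_fin_succ, IsEmpty.forall_iff, and_true, Pi.sub_apply,
    Matrix.cons_val_zero, Matrix.cons_val_succ, Fin.succ_zero_eq_one, Fin.succ_one_eq_two, h2,
    sub_self]
  exact ⟨⟨hia1, hia2⟩, ⟨hib1, hib2⟩, by omega, by omega⟩

/-- **Last visit to the lower half.** An open bottom-to-top path of the piece (lattice configuration)
passes through a mid-layer vertex `b` (`b₂ = lm`) from which the top is reached inside the piece. -/
theorem exists_mid {m l L : ℕ} (hm : 1 ≤ m) (hl : 2 ≤ l) {ω : BondConfig (Site 3)}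
    (hω : ω ⊆ (zdGraph 3).edgeSet) {x y : Site 3}
    (hx : x ∈ Set.Icc (![0, 0, 0] : Site 3) ![(L : ℤ), (L : ℤ), 0])
    (hy : y ∈ Set.Icc (![0, 0, ((2 * l * m : ℕ) : ℤ)] : Site 3) ![(L : ℤ), (L : ℤ), ((2 * l * m : ℕ) : ℤ)])
    (hp : PathIn (openGraph ω)
      (Set.Icc (![0, 0, 0] : Site 3) ![(L : ℤ), (L : ℤ), ((2 * l * m : ℕ) : ℤ)]) x y) :
    ∃ b : Site 3, (0 ≤ b 0 ∧ b 0 ≤ L) ∧ (0 ≤ b 1 ∧ b 1 ≤ L) ∧ b 2 = ((l * m : ℕ) : ℤ) ∧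
      PathIn (openGraph ω) (Set.Icc (![0, 0, 0] : Site 3) ![(L : ℤ), (L : ℤ), ((2 * l * m : ℕ) : ℤ)])
        b y := by
  have hlm : 1 ≤ l * m := le_trans hm (Nat.le_mul_of_pos_left m (by omega))
  have e1 : ((2 * l * m : ℕ) : ℤ) = 2 * ((l * m : ℕ) : ℤ) := by push_cast; ring
  rw [mem_Icc_vec3] at hx hy
  have hxC : x ∈ {v : Site 3 | v 2 < ((l * m : ℕ) : ℤ)} := by simp only [Set.mem_setOf_eq]; omega
  have hyC : y ∉ {v : Site 3 | v 2 < ((l * m : ℕ) : ℤ)} := by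
    simp only [Set.mem_setOf_eq, not_lt]; omega
  obtain ⟨a, b, haC, -, hbC, hab, hpb⟩ := hp.last_exit hxC hyC
  simp only [Set.mem_setOf_eq, not_lt] at haC hbC
  have hab1 := DCT16.abs_sub_le_one_of_adj (DCT16.adj_of_openGraph_adj hω hab) 2
  rw [abs_le] at hab1
  have hbQ := hpb.left_mem.1
  rw [mem_Icc_vec3] at hbQ
  exact ⟨b, hbQ.1, hbQ.2.1, by omega, hpb.mono Set.sdiff_subset⟩

/-- **Crossing of a translated annulus.** An open path (lattice configuration) from `b ∈ c + B(m)` to a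
vertex `y` at height `y₂ = c₂ + lm` either stays in `c + B(lm)` — then `y` is on its inner vertex
boundary — or first leaves `c + B(lm)` through its inner vertex boundary. -/
theorem cross_annulus {m l : ℕ} (hl : 2 ≤ l) {ω : BondConfig (Site 3)}
    (hω : ω ⊆ (zdGraph 3).edgeSet) {T : Set (Site 3)} {c b y : Site 3}
    (hc : c 2 = ((l * m : ℕ) : ℤ)) (hb : b - c ∈ box 3 m) (hy2 : y 2 = ((2 * l * m : ℕ) : ℤ))
    (hp : PathIn (openGraph ω) T b y) :
    ∃ x' ∈ (· + c) '' (↑(box 3 m) : Set (Site 3)),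
      ∃ y' ∈ (· + c) '' (↑(innerBoundary (zdGraph 3) (box 3 (l * m))) : Set (Site 3)),
        ω ∈ openConnIn ((· + c) '' (↑(box 3 (l * m)) : Set (Site 3))) x' y' := by
  have hml : m ≤ l * m := Nat.le_mul_of_pos_left m (by omega)
  have e1 : ((2 * l * m : ℕ) : ℤ) = 2 * ((l * m : ℕ) : ℤ) := by push_cast; ring
  have hbR : b ∈ (· + c) '' (↑(box 3 (l * m)) : Set (Site 3)) :=
    mem_image_add_iff.2 (Finset.mem_coe.2 (box_mono 3 hml hb))
  refine ⟨b, mem_image_add_iff.2 (Finset.mem_coe.2 hb), ?_⟩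
  rcases hp.exit_or hbR with hstay | ⟨a', b', ha'R, hb'R, -, hab', hpa'⟩
  · have hyR : y - c ∈ box 3 (l * m) :=
      Finset.mem_coe.1 (mem_image_add_iff.1 hstay.right_mem.1)
    refine ⟨y, mem_image_add_iff.2 (Finset.mem_coe.2 ?_),
      DCT16.mem_openConnIn_of_pathIn (hstay.mono Set.inter_subset_left)⟩
    rw [mem_innerBoundary_iff]
    refine ⟨hyR, y - c + Pi.single 2 1, fun h => ?_, (zdGraph_adj_iff _ _).2 ⟨2, Or.inl rfl⟩⟩
    have h2 := (mem_box.1 h) 2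
    simp only [Pi.add_apply, Pi.sub_apply, Pi.single_eq_same] at h2
    omega
  · refine ⟨a', mem_image_add_iff.2 (Finset.mem_coe.2 ?_),
      DCT16.mem_openConnIn_of_pathIn (hpa'.mono Set.inter_subset_left)⟩
    rw [mem_innerBoundary_iff]
    refine ⟨Finset.mem_coe.1 (mem_image_add_iff.1 ha'R), b' - c,
      fun h => hb'R (mem_image_add_iff.2 (Finset.mem_coe.2 h)), ?_⟩
    have hadj := (zdGraph_adj_shift_iff (-c) a' b').2 (DCT16.adj_of_openGraph_adj hω hab')
    simpa only [Site.shift_apply, ← sub_eq_add_neg] using hadj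

/-- **Routing.** For a lattice configuration, every open bottom-to-top crossing of the piece
`[0, L]² × [0, 2lm]` crosses one of the translated annuli `c + (B(m) → ∂ⁱⁿB(lm))` inside `c + B(lm)`,
`c` in the net of `≤ A²` centres, `A = (L + 2m + 1)/(2m+1)`. -/
theorem route {m l L : ℕ} (hm : 1 ≤ m) (hl : 2 ≤ l) {ω : BondConfig (Site 3)}
    (hω : ω ⊆ (zdGraph 3).edgeSet) {x y : Site 3}
    (hx : x ∈ Set.Icc (![0, 0, 0] : Site 3) ![(L : ℤ), (L : ℤ), 0])
    (hy : y ∈ Set.Icc (![0, 0, ((2 * l * m : ℕ) : ℤ)] : Site 3) ![(L : ℤ), (L : ℤ), ((2 * l * m : ℕ) : ℤ)])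
    (hxy : ω ∈ openConnIn (Set.Icc (![0, 0, 0] : Site 3) ![(L : ℤ), (L : ℤ), ((2 * l * m : ℕ) : ℤ)]) x y) :
    ∃ c ∈ (Finset.range ((L + 2 * m + 1) / (2 * m + 1)) ×ˢ
        Finset.range ((L + 2 * m + 1) / (2 * m + 1))).image fun ab : ℕ × ℕ =>
          (![(((2 * m + 1) * ab.1 + m : ℕ) : ℤ), (((2 * m + 1) * ab.2 + m : ℕ) : ℤ),
            ((l * m : ℕ) : ℤ)] : Site 3),
      ∃ x' ∈ (· + c) '' (↑(box 3 m) : Set (Site 3)),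
      ∃ y' ∈ (· + c) '' (↑(innerBoundary (zdGraph 3) (box 3 (l * m))) : Set (Site 3)),
        ω ∈ openConnIn ((· + c) '' (↑(box 3 (l * m)) : Set (Site 3))) x' y' := by
  obtain ⟨b, h0, h1, h2, hpb⟩ := exists_mid hm hl hω hx hy (DCT16.pathIn_of_mem_openConnIn hxy)
  obtain ⟨c, hc, hbc, hc2⟩ := exists_net_centre m l L h0 h1 h2
  have hy2 : y 2 = ((2 * l * m : ℕ) : ℤ) := by
    rw [mem_Icc_vec3] at hy
    exact le_antisymm hy.2.2.2 hy.2.2.1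
  exact ⟨c, hc, cross_annulus hl hω hc2 hbc hy2 hpb⟩

end StubPatchCutset

open StubPatchCutset in
/-- **`stub_patchCutset` (registered stub of line `Sketch`, crux stmt-CriticalPhenomena-5248): the
patch-cutset inequality** `E_p[S(L, 2lm)] ≤ ⌈(L+1)/(2m+1)⌉² · E_p[MinCut(m, lm)]` for `1 ≤ m`, `2 ≤ l`,
every `L` and `p`: a.s. the bottom-to-top min-cut of the piece `[0, L]² × [0, 2lm]` is at most the sum
of the budgets of the `≤ ⌈(L+1)/(2m+1)⌉²` translated annuli of the net (routing + gluing of optimal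
cutsets), each of expected budget `E_p[MinCut(m, lm)]` by translation invariance. -/
theorem stub_patchCutset :
    ∀ (p : unitInterval) (m l L : ℕ), 1 ≤ m → 2 ≤ l →
      ∫ ω, ((minOpenCutIn
          (Set.Icc (![0, 0, 0] : Site 3) ![(L : ℤ), (L : ℤ), ((2 * l * m : ℕ) : ℤ)])
          (Set.Icc (![0, 0, 0] : Site 3) ![(L : ℤ), (L : ℤ), 0])
          (Set.Icc (![0, 0, ((2 * l * m : ℕ) : ℤ)] : Site 3) ![(L : ℤ), (L : ℤ), ((2 * l * m : ℕ) : ℤ)])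
          ω).toNat : ℝ) ∂(bondPercolation (zdGraph 3) p) ≤
      ((((L + 2 * m + 1) / (2 * m + 1) : ℕ) : ℝ)) ^ 2 *
        ∫ ω, ((minOpenCutIn (↑(box 3 (l * m)) : Set (Site 3)) (↑(box 3 m) : Set (Site 3))
          (↑(innerBoundary (zdGraph 3) (box 3 (l * m))) : Set (Site 3)) ω).toNat : ℝ)
          ∂(bondPercolation (zdGraph 3) p) := by
  intro p m l L hm hl
  refine (integral_piece_le_card_mul p hm hl _
    fun ω hω x hx y hy hxy => route hm hl hω hx hy hxy).trans
    (mul_le_mul_of_nonneg_right ?_ (integral_nonneg fun ω => Nat.cast_nonneg _))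
  exact_mod_cast Finset.card_image_le.trans (by rw [Finset.card_product, Finset.card_range, sq])

end Summit.CriticalPhenomena.PercolationContinuityZ3.Theorems.BudgetTightness

end
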